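import Summits.QuantumFields.YangMills.Theorems.BalabanUVNodesN21HistoriesMarginalEnvelopes

/-!
# N21 (NE7c) — module 20n «THE RESAMPLING TOWER» (LENS nearmiss ROW A⁸, v10.0 Cards 29∕30): print's ℝ [IV] (0.3) realised on histories as «keep the
# term's law OFF the conditional-integration fibre, RESAMPLE the fibre variables from the receiving term's conditional law»; then every window slot's
# `u_s`-marginal is enveloped by the OLDER-CAUSAL pre-ℝ total of its own level up to ONE local number `δ_loc` and the end-tilt — 20m's §AM binders

PROVENANCE AND CREDIT.  This module is the planner seat `ym-lens-BalabanUVNodes-nearmiss`'s `Sketch-nearmiss-g10.lean` §L∕§N∕§T∕§D∕§J (sha16 cf6ca6ea925d752d;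
memo `LENS-nearmiss.md` v10.0 Cards 29∕30∕26′, §4 ROW A⁸) landed VERBATIM by seat `pub-ymgap-dag-n21-e` (g8) under dag-lead g9 DEDUP-269 «A⁷ 20m AND A⁸ 20n =
dag-n21-e g8» (bus l.18414; dag-n21-d g6 NOT-MINE l.18402); only this header, the namespace and the import of 20m are the filer's.  Lane: `--kind proof
--supports stmt-QuantumFields-20292 --as helper` (K3⁗ `SpineGivenEndpointR13Sep`).  Count-neutral.

THE IDEA (lens Cards 29∕30; the lens's WHY paragraph abridged).  def-R FILE 7 types (0.3) as `t′_{s′} = t_{s′}·Σ_{s ∈ sel⁻¹ s′} ratio_s`, `ratio_s =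
∫_{fib s} t_s ∕ ∫_{fib s} t_{s′}` a function of the OFF-fibre variables (n21-e files 20–23: the summand distributed back to the pre-image `s` keeps `s`'s
off-fibre sharp factor, (0.4) per summand; `δ_loc`'s summands are def-R's `rratio`).  The RESAMPLING LIFT — `J_s :=` the law of `s` with the fibre variables
RESAMPLED from `t_{s′}(· | V off fib s)`, `V_k`-density `t_{s′}·ratio_s` — gives: (N) past statistics and `V_k` off `fib s` keep their marginals EXACTLY;
(Eoff) so does a level-`k` slot missing `fib s`; (Eon) the ON slots of each `sel`-fibre are dominated by `δ_loc ×` the pre-ℝ marginals of the OFF terms of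
the same fibre (§D: `δ_loc` = the sup of the fibre-ratio sum over the near components — lens Card 30, [IV] p.176 L18–26, (1.89)–(1.102), [LF-II] §1; its
`K`-uniformity is NODE O's ∕ def-R's); (P) 𝐓-steps = «label partition of unity × conditional kernel»; (Mass) (0.4) per stage; (Tilt) the `t`-run family is
the end-tilt (`|F| ≤ B`) of the `t = 0` tower's final stage.  THEOREM (§N∕§T∕§J): (P)+(N) reduce the `u_c`-marginal of any sub-sum of final-stage terms to
stage `j = lvl c`; there ONE ℝ-step costs `(1+δ_loc)` against the pre-ℝ stage-`j` total `TotPre_j` — OLDER-CAUSAL (`hdepTot`), mass = the partition function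
up to the tilt ⇒ 20m §AM's binders with `law K a s := (TotPre^{K,a}_{lvl s}).map (u K s)`, `M₁ = e^{l₀B}(1+δ_loc)`, `M₂ = e^{−l₀B}` (★★ §J).

HONEST FRAMING.  NE7c is NOT PRINTED and NOT PROVED.  [folklore] bookkeeping (`Measure.map`, `withDensity`, finite sums, one induction on the stage);
the tower hypotheses (P)(N)(Eoff)(Eon)(Mass)(Tilt) are BINDERS to be discharged by the owner of the ℝ∕𝐓 tower (NODE O ∕ def-R ∕ dag-n19-d; lens ROW B′)
— this file only shows they are the RIGHT currency; `δ_loc` is DISPLAYED, never estimated; nothing of Bałaban's asserted; (M1) at print's FIXED thresholds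
untouched; N21 NOT discharged; count-neutral; one finite 𝕋⁴ at fixed `ε`; NOT ℝ⁴ ∕ OS ∕ gap ∕ Clay.

CITATION HEADER (lean-in-tree rule 2026-08-18).  BY NAME: 20m (§M∕§AM); 20k `N21HistoriesAbsorbingDefs.Absorbing` ∕ `histLaw_eq_restrict` ∕ `histWeight_of_absorbing`;
20h `N21HistoriesModelADefs.withDensity_finsetSum'`; `T4LimitDensity.smul_le_smul_measure`; leaf `ShellMeasureRootCompositionHistories.histLaw` ∕ `partialLaw` ∕ `histWeight`.
Context only (SHAPE): [Balaban1989LargeFieldI] (0.3)–(0.4) p. 176 (L18–26 *"the quotients are still small …"*); (1.99)–(1.102) pp. 200–201.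

WHAT IS PROVED ([folklore]).  §L `measureMap_finsetSum` · `histLaw_le_law`; §N∕§T ★ `sum_map_le_of_offOn` · `stageSum_eq_succ` · `totPre_univ_eq_final` · ★ `sum_map_le_totPre`;
§D `sum_withDensity_mul_le` · `sum_map_withDensity_mul_le`; §J ★ `marginalEnvelope_of_tower` · ★ `mass_of_tower` · ★★ `shellWeightBound_histories_of_resamplingTower`.
-/

open scoped BigOperators ENNReal
open MeasureTheory Set

namespace Summit.QuantumFields.YangMills.Theorems.N21HistoriesResamplingTower

open Summit.QuantumFields.YangMills.Theorems.N21HistoriesMarginalEnvelopes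

open Literature.MathematicalPhysics.QuantumFieldTheory.Balaban1983to89
open Literature.MathematicalPhysics.QuantumFieldTheory.Balaban1983to89.T4ShellMeasure (SlotAntiConcentration)
open T4IndicatorShell (smallInd ShellWeightBound)
open T4ShellMeasureLevels (LevelLedger LiveWindow)
open Summit.QuantumFields.BalabanUV.T4Continuum.ShellMeasureRootCompositionHistories
  (smallProd histWeight histShell histPiece histLaw partialLaw histShell_nonneg histShell_le_histWeight histShell_le_sum_piece sum_histPiece_le
    integral_piece_le isFiniteMeasure_histLaw)
open Summit.QuantumFields.YangMills.Theorems (n21_knit_levels_geometric)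
open Summit.QuantumFields.YangMills.Theorems.N21SelectedThresholds (exists_goodAssignment levelLedger_of_goodAssignment levelConst_le)
open Summit.QuantumFields.YangMills.Theorems.N21SelectedThresholdsHistories (toReal_le_of_le_smul)
open Summit.QuantumFields.YangMills.Theorems.N21HistoriesAbsorbingDefs (Absorbing ae_close_of_absorbing histLaw_eq_restrict histWeight_of_absorbing)
open Literature.MathematicalPhysics.QuantumFieldTheory.Balaban1983to89.T4LimitDensity (smul_le_smul_measure)
open Summit.QuantumFields.YangMills.Theorems.N21HistoriesModelADefs (withDensity_finsetSum')

/-! ## §L bookkeeping: `Measure.map` of finite sums, `histLaw ≤ law` -/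

section Lemmas

variable {Ω : Type*} [MeasurableSpace Ω]

/-- `Measure.map` of a finite sum of measures. [folklore] -/
theorem measureMap_finsetSum {ι : Type*} (F : Finset ι) (μ : ι → Measure Ω) {u : Ω → ℝ} (hu : Measurable u) :
    (∑ i ∈ F, μ i).map u = ∑ i ∈ F, (μ i).map u := by
  classical
  refine Finset.induction_on F ?_ ?_
  · simp
  · intro i F hi ih
    rw [Finset.sum_insert hi, Finset.sum_insert hi, Measure.map_add _ _ hu, ih]

/-- a history's law is below its term law, `histLaw ν ≤ ν` (density `smallProd ≤ 1`; NO absorption needed on this side). [folklore] -/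
theorem histLaw_le_law {σ : Type*} (ν : Measure Ω) (sm : Finset σ) {u : σ → Ω → ℝ} (hu : ∀ s, Measurable (u s)) (ϑ : σ → ℝ) :
    histLaw ν sm u ϑ ≤ ν := by
  rw [histLaw_eq_restrict ν sm hu ϑ]
  exact Measure.restrict_le_self

/-! `c • μ ≤ c • ν` from `μ ≤ ν` is `T4LimitDensity.smul_le_smul_measure le_rfl`; `withDensity` of a finite sum of densities is 20h's
`N21HistoriesModelADefs.withDensity_finsetSum'` — both CITED BY NAME (in this import closure).  `measureMap_finsetSum` = NE1p's
`DressedMGFForm.map_finset_sum`, which is NOT in this import closure (re-derived in four lines rather than widening the imports). -/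

end Lemmas

/-! ## §N∕§T ONE ℝ-STEP AND THE TOWER under the RESAMPLING LIFT

One stage: index set `I` of terms, post-ℝ laws `J s` and pre-ℝ laws `Jpre s` on a common space (histories ∕ path space), print's selector
`sel`, and for a FIXED statistic `u` (one window slot) the set `On` of terms whose conditional-integration fibre MEETS the support of `u`.
OFF terms keep the `u`-marginal exactly (`hoff`, the resampling lift's neutrality); ON terms are dominated FIBREWISE over `sel` by
`δ ×` the pre-ℝ marginals of the OFF terms of the same fibre (`hon`, Card 30's `δ_loc` — a sup over the ≤ `(2R̃∕M+1)^4` admissible components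
whose conditional-integration neighbourhood meets the slot; the far components' resampling is already inside the OFF terms).  The tower: stages `k ≤ K`, prefix maps `pre k : I (k+1) → I k` with the
partition-of-unity ∕ kernel identity (P) `Σ_{pre e = s} Jpre (k+1) e = J k s`, and neutrality (N) of every later stage for `u` of level `j`. -/

section Tower

variable {Ω : Type*} [MeasurableSpace Ω] {ι : Type*} [DecidableEq ι]

/-- **ONE ℝ-STEP, ONE STATISTIC**: OFF terms keep the `u`-marginal (`hoff`); the ON terms of each `sel`-fibre are dominated by `δ ×` the pre-ℝ
marginals of the OFF terms of the SAME fibre (`hon` — the receiving term `s′ = sel s′` is one of them; print p.176: «the quotients are still small,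
because some small factors in the regions Z′ are left», localised near the erased components) ⟹ `(Σ_{s ∈ I} J s).map u ≤ (1 + δ) • (Σ_{s ∈ I} Jpre s).map u`.
[folklore] -/
theorem sum_map_le_of_offOn (I : Finset ι) (J Jpre : ι → Measure Ω) (sel : ι → ι) (On : Finset ι) {u : Ω → ℝ}
    (hu : Measurable u) {δ : ℝ≥0∞}
    (hsel : ∀ s ∈ I, sel s ∈ I)
    (hoff : ∀ s ∈ I, s ∉ On → (J s).map u = (Jpre s).map u)
    (hon : ∀ s' ∈ I, ∑ s ∈ I.filter (fun s => s ∈ On ∧ sel s = s'), (J s).map u ≤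
      δ • ∑ s ∈ I.filter (fun s => s ∉ On ∧ sel s = s'), (Jpre s).map u) :
    (∑ s ∈ I, J s).map u ≤ (1 + δ) • (∑ s ∈ I, Jpre s).map u := by
  have hsub : ∑ s ∈ I.filter (fun s => s ∉ On), (Jpre s).map u ≤ ∑ s ∈ I, (Jpre s).map u :=
    Finset.sum_le_sum_of_subset_of_nonneg (Finset.filter_subset _ _) fun _ _ _ => Measure.zero_le _
  have hoff' : ∑ s ∈ I.filter (fun s => s ∉ On), (J s).map u ≤ ∑ s ∈ I, (Jpre s).map u :=
    (Finset.sum_congr rfl fun s hs => hoff s (Finset.mem_filter.1 hs).1 (Finset.mem_filter.1 hs).2).le.trans hsub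
  have hon' : ∑ s ∈ I.filter (fun s => s ∈ On), (J s).map u ≤ δ • ∑ s ∈ I, (Jpre s).map u := by
    refine le_trans ?_ (smul_le_smul_measure le_rfl hsub)
    rw [← Finset.sum_fiberwise_of_maps_to (s := I.filter (fun s => s ∈ On)) (t := I) (g := sel)
        (fun s hs => hsel s (Finset.mem_filter.1 hs).1),
      ← Finset.sum_fiberwise_of_maps_to (s := I.filter (fun s => s ∉ On)) (t := I) (g := sel)
        (fun s hs => hsel s (Finset.mem_filter.1 hs).1), Finset.smul_sum]
    refine Finset.sum_le_sum fun s' hs' => ?_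
    rw [Finset.filter_filter, Finset.filter_filter]
    exact hon s' hs'
  rw [measureMap_finsetSum I J hu, measureMap_finsetSum I Jpre hu, ← Finset.sum_filter_add_sum_filter_not I (fun s => s ∈ On)]
  calc ∑ s ∈ I.filter (fun s => s ∈ On), (J s).map u + ∑ s ∈ I.filter (fun s => s ∉ On), (J s).map u
      ≤ δ • ∑ s ∈ I, (Jpre s).map u + ∑ s ∈ I, (Jpre s).map u := add_le_add hon' hoff'
    _ = (1 + δ) • ∑ s ∈ I, (Jpre s).map u := by rw [add_smul, one_smul, add_comm]

/-- **(P) TELESCOPES THE STAGE SUMS**: `Σ_{s ∈ I k} J k s = Σ_{e ∈ I (k+1)} Jpre (k+1) e`. [folklore] -/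
theorem stageSum_eq_succ (I : ℕ → Finset ι) (J Jpre : ℕ → ι → Measure Ω) (pre : ℕ → ι → ι) (k : ℕ)
    (hpre : ∀ e ∈ I (k + 1), pre k e ∈ I k)
    (hP : ∀ s ∈ I k, ∑ e ∈ (I (k + 1)).filter (fun e => pre k e = s), Jpre (k + 1) e = J k s) :
    ∑ s ∈ I k, J k s = ∑ e ∈ I (k + 1), Jpre (k + 1) e := by
  rw [← Finset.sum_fiberwise_of_maps_to hpre (Jpre (k + 1))]
  exact (Finset.sum_congr rfl hP).symm

/-- **MASS CHAIN** ((Mass) + (P)): the pre-ℝ stage-`j` total has the mass of the final stage. [folklore] -/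
theorem totPre_univ_eq_final (K : ℕ) (I : ℕ → Finset ι) (J Jpre : ℕ → ι → Measure Ω) (pre : ℕ → ι → ι)
    (hpre : ∀ k, k < K → ∀ e ∈ I (k + 1), pre k e ∈ I k)
    (hP : ∀ k, k < K → ∀ s ∈ I k, ∑ e ∈ (I (k + 1)).filter (fun e => pre k e = s), Jpre (k + 1) e = J k s)
    (hmass : ∀ k, k ≤ K → (∑ s ∈ I k, J k s) univ = (∑ s ∈ I k, Jpre k s) univ) {j : ℕ} (hj : j ≤ K) :
    (∑ e ∈ I j, Jpre j e) univ = (∑ s ∈ I K, J K s) univ := by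
  suffices h : ∀ n j, j + n = K → (∑ e ∈ I j, Jpre j e) univ = (∑ s ∈ I K, J K s) univ from h (K - j) j (by omega)
  intro n
  induction n with
  | zero =>
    intro j hjK
    rw [Nat.add_zero] at hjK
    subst hjK
    exact (hmass j le_rfl).symm
  | succ n ih =>
    intro j hjK
    have hjlt : j < K := by omega
    rw [← hmass j hjlt.le, stageSum_eq_succ I J Jpre pre j (hpre j hjlt) (hP j hjlt)]
    exact ih (j + 1) (by omega)

/-- **THE TOWER REDUCTION**: for a statistic `u` of level `j ≤ K` — (N) neutral at stages `k > j`, (P) at all stages, one ℝ-step at stage `j` —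
every sub-sum of final-stage terms has `u`-marginal `≤ (1 + δ) • (TotPre_j).map u`, `TotPre_j := Σ_{e ∈ I j} Jpre j e`. [folklore] -/
theorem sum_map_le_totPre (K : ℕ) (I : ℕ → Finset ι) (J Jpre : ℕ → ι → Measure Ω) (pre sel : ℕ → ι → ι) (On : ℕ → Finset ι)
    {u : Ω → ℝ} (hu : Measurable u) {δ : ℝ≥0∞} {j : ℕ} (hj : j ≤ K)
    (hpre : ∀ k, k < K → ∀ e ∈ I (k + 1), pre k e ∈ I k)
    (hP : ∀ k, k < K → ∀ s ∈ I k, ∑ e ∈ (I (k + 1)).filter (fun e => pre k e = s), Jpre (k + 1) e = J k s)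
    (hN : ∀ k, j < k → k ≤ K → ∀ s ∈ I k, (J k s).map u = (Jpre k s).map u)
    (hsel : ∀ s ∈ I j, sel j s ∈ I j)
    (hoff : ∀ s ∈ I j, s ∉ On j → (J j s).map u = (Jpre j s).map u)
    (hon : ∀ s' ∈ I j, ∑ s ∈ (I j).filter (fun s => s ∈ On j ∧ sel j s = s'), (J j s).map u ≤
      δ • ∑ s ∈ (I j).filter (fun s => s ∉ On j ∧ sel j s = s'), (Jpre j s).map u)
    (S : Finset ι) (hS : S ⊆ I K) :
    (∑ s ∈ S, J K s).map u ≤ (1 + δ) • (∑ e ∈ I j, Jpre j e).map u := by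
  have hmono : (∑ s ∈ S, J K s).map u ≤ (∑ s ∈ I K, J K s).map u :=
    Measure.map_mono (Finset.sum_le_sum_of_subset_of_nonneg hS fun _ _ _ => Measure.zero_le _) hu
  refine hmono.trans ?_
  suffices h : ∀ n, j + n ≤ K → (∑ s ∈ I (j + n), J (j + n) s).map u ≤ (1 + δ) • (∑ e ∈ I j, Jpre j e).map u by
    have := h (K - j) (by omega)
    rwa [Nat.add_sub_cancel' hj] at this
  intro n
  induction n with
  | zero =>
    intro _
    exact sum_map_le_of_offOn (I j) (J j) (Jpre j) (sel j) (On j) hu hsel hoff hon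
  | succ n ih =>
    intro hle
    have hlt : j + n < K := by omega
    show (∑ s ∈ I (j + n + 1), J (j + n + 1) s).map u ≤ _
    rw [measureMap_finsetSum _ _ hu,
      Finset.sum_congr rfl fun s hs => hN (j + n + 1) (by omega) (by omega) s hs,
      ← measureMap_finsetSum _ _ hu, ← stageSum_eq_succ I J Jpre pre (j + n) (hpre _ hlt) (hP _ hlt)]
    exact ih hlt.le

end Tower

/-! ## §D the density reading of (Eon): `δ_loc` is exactly the sup of the fibre ratio sum -/

section Density

variable {Ω : Type*} [MeasurableSpace Ω] {ι : Type*}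

/-- **`δ_loc` IS WHAT `hon` CONSUMES.**  On the current field's space with base `γ`: `g` = the density of the OFF part of a `sel`-fibre (the
receiving term `s′` and its pre-images erasing only FAR components — on `σ(V_k)` their post-ℝ densities, whose `u_c`-marginals are pre-ℝ by `hoff`),
and each NEAR choice `n ∈ F` (a non-empty set of admissible components meeting the slot's neighbourhood) contributes density `g · r_n`, `r_n` = print's
fibre-integral RATIO of the near components (def-R FILE 7 `rratio`, a function of the variables off their fibre, `≤` their small factors up to the
localisation error); `Σ_{n ∈ F} r_n ≤ δ` pointwise ⟹ `Σ_{n ∈ F} J_n ≤ δ • J^{OFF}`. [folklore] -/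
theorem sum_withDensity_mul_le (γ : Measure Ω) (F : Finset ι) {g : Ω → ℝ≥0∞} {r : ι → Ω → ℝ≥0∞} (hg : Measurable g)
    (hr : ∀ s, Measurable (r s)) {δ : ℝ≥0∞} (hδ : ∀ x, ∑ s ∈ F, r s x ≤ δ) :
    ∑ s ∈ F, γ.withDensity (fun x => g x * r s x) ≤ δ • γ.withDensity g := by
  rw [← withDensity_finsetSum' F γ (fun s x => g x * r s x) fun s => hg.mul (hr s), ← withDensity_smul δ hg]
  refine withDensity_mono (Filter.Eventually.of_forall fun x => ?_)
  simp only [Pi.smul_apply, smul_eq_mul]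
  rw [← Finset.mul_sum, mul_comm]
  exact mul_le_mul' (hδ x) le_rfl

/-- … hence for the marginal of every statistic: the shape of `hon`. [folklore] -/
theorem sum_map_withDensity_mul_le (γ : Measure Ω) (F : Finset ι) {g : Ω → ℝ≥0∞} {r : ι → Ω → ℝ≥0∞} (hg : Measurable g)
    (hr : ∀ s, Measurable (r s)) {δ : ℝ≥0∞} (hδ : ∀ x, ∑ s ∈ F, r s x ≤ δ) {u : Ω → ℝ} (hu : Measurable u) :
    ∑ s ∈ F, (γ.withDensity fun x => g x * r s x).map u ≤ δ • (γ.withDensity g).map u := by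
  rw [← measureMap_finsetSum F _ hu, ← Measure.map_smul]
  exact Measure.map_mono (sum_withDensity_mul_le γ F hg hr hδ) hu

end Density

/-! ## §J THE JUNCTION: the resampling tower's laws feed §AM verbatim — `law K a s := (TotPre^{K,a}_{lvl s}).map (u K s)`,
`M₁ = e^{l₀B}(1+δ)`, `M₂ = e^{−l₀B}` -/

section Resampling

variable {Ω : ℕ → Type*} [∀ K, MeasurableSpace (Ω K)] {σ ι : Type*} [DecidableEq σ] [DecidableEq ι]
  {T : ℕ → Finset ι} {C : ℕ → Finset σ} {small smAll : ℕ → ι → Finset σ} {nbhd : ℕ → ι → σ → Finset σ} {lvl : ℕ → σ → ℕ}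
  {I : ℕ → ℕ → Finset ι} {pre sel : ℕ → ℕ → ι → ι} {On : ℕ → ℕ → σ → Finset ι}
  {θ κ ρ Δ : ℕ → ℝ} {l₀ νbar δr B : ℝ}

section OneRunTower

variable {ν : ∀ K : ℕ, (ℕ → ℝ) → ℝ → ι → Measure (Ω K)} [∀ K a t τ, IsFiniteMeasure (ν K a t τ)]
  {J Jpre : ∀ K : ℕ, (ℕ → ℝ) → ℕ → ι → Measure (Ω K)} [∀ K a k e, IsFiniteMeasure (J K a k e)] [∀ K a k e, IsFiniteMeasure (Jpre K a k e)]
  {u : ∀ K : ℕ, σ → Ω K → ℝ}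

omit [∀ K a t τ, IsFiniteMeasure (ν K a t τ)] [∀ K a k e, IsFiniteMeasure (J K a k e)] [∀ K a k e, IsFiniteMeasure (Jpre K a k e)] in
/-- **THE MARGINAL ENVELOPE OF ONE RUN FROM ITS RESAMPLING TOWER** (`henv` of §AM with `M₁ = e^{l₀B}(1+δ)`): pieces `≤` term laws (`histLaw ≤ law`)
`≤ e^{l₀B} ×` the `t = 0` tower's final stage (Tilt); the tower reduction §T for `u K s` of level `lvl K s ≤ K`. [folklore] -/
theorem marginalEnvelope_of_tower (hu : ∀ K s, Measurable (u K s)) (hle : ∀ K, ∀ s ∈ C K, lvl K s ≤ K) (hδ : 0 ≤ δr)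
    (hpre : ∀ K k, k < K → ∀ e ∈ I K (k + 1), pre K k e ∈ I K k) (hIT : ∀ K, I K K = T K)
    (hsel : ∀ K k, ∀ s ∈ I K k, sel K k s ∈ I K k)
    (hP : ∀ (K : ℕ) (a : ℕ → ℝ), (∀ j, a j ∈ Icc ((1 - κ j) * θ j) (θ j)) → ∀ k, k < K → ∀ s ∈ I K k,
      ∑ e ∈ (I K (k + 1)).filter (fun e => pre K k e = s), Jpre K a (k + 1) e = J K a k s)
    (hN : ∀ (K : ℕ) (a : ℕ → ℝ), (∀ j, a j ∈ Icc ((1 - κ j) * θ j) (θ j)) → ∀ c ∈ C K, ∀ k, lvl K c < k → k ≤ K → ∀ s ∈ I K k,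
      (J K a k s).map (u K c) = (Jpre K a k s).map (u K c))
    (hoff : ∀ (K : ℕ) (a : ℕ → ℝ), (∀ j, a j ∈ Icc ((1 - κ j) * θ j) (θ j)) → ∀ c ∈ C K, ∀ s ∈ I K (lvl K c), s ∉ On K (lvl K c) c →
      (J K a (lvl K c) s).map (u K c) = (Jpre K a (lvl K c) s).map (u K c))
    (hon : ∀ (K : ℕ) (a : ℕ → ℝ), (∀ j, a j ∈ Icc ((1 - κ j) * θ j) (θ j)) → ∀ c ∈ C K, ∀ s' ∈ I K (lvl K c),
      ∑ s ∈ (I K (lvl K c)).filter (fun s => s ∈ On K (lvl K c) c ∧ sel K (lvl K c) s = s'), (J K a (lvl K c) s).map (u K c) ≤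
        ENNReal.ofReal δr • ∑ s ∈ (I K (lvl K c)).filter (fun s => s ∉ On K (lvl K c) c ∧ sel K (lvl K c) s = s'), (Jpre K a (lvl K c) s).map (u K c))
    (htilt : ∀ (K : ℕ) (a : ℕ → ℝ), (∀ j, a j ∈ Icc ((1 - κ j) * θ j) (θ j)) → ∀ t, |t| ≤ l₀ → ∀ τ ∈ T K,
      ν K a t τ ≤ ENNReal.ofReal (Real.exp (l₀ * B)) • J K a K τ ∧ J K a K τ ≤ ENNReal.ofReal (Real.exp (l₀ * B)) • ν K a t τ)
    (K : ℕ) (a : ℕ → ℝ) (ha : ∀ j, a j ∈ Icc ((1 - κ j) * θ j) (θ j)) (t : ℝ) (ht : |t| ≤ l₀) (s : σ) (hs : s ∈ C K) :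
    (partialLaw (T K) (ν K a t) (small K) (u K) (fun s => a (lvl K s)) s).map (u K s) ≤
      ENNReal.ofReal (Real.exp (l₀ * B) * (1 + δr)) • (∑ e ∈ I K (lvl K s), Jpre K a (lvl K s) e).map (u K s) := by
  -- (1) pieces ≤ term laws ≤ e^{l₀B} × the tower's final stage
  have h1 : partialLaw (T K) (ν K a t) (small K) (u K) (fun s => a (lvl K s)) s ≤
      ENNReal.ofReal (Real.exp (l₀ * B)) • ∑ τ ∈ (T K).filter (fun τ => s ∈ small K τ), J K a K τ := by
    rw [partialLaw, Finset.smul_sum]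
    exact Finset.sum_le_sum fun τ hτ =>
      (histLaw_le_law _ _ (hu K) _).trans (htilt K a ha t ht τ (Finset.mem_filter.1 hτ).1).1
  -- (2) the tower reduction for the statistic `u K s` of level `lvl K s`
  have h2 : (∑ τ ∈ (T K).filter (fun τ => s ∈ small K τ), J K a K τ).map (u K s) ≤
      (1 + ENNReal.ofReal δr) • (∑ e ∈ I K (lvl K s), Jpre K a (lvl K s) e).map (u K s) :=
    sum_map_le_totPre K (I K) (J K a) (Jpre K a) (pre K) (sel K) (fun k => On K k s) (hu K s) (hle K s hs)
      (hpre K) (hP K a ha) (hN K a ha s hs) (hsel K (lvl K s)) (hoff K a ha s hs) (hon K a ha s hs) _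
      ((Finset.filter_subset _ _).trans (Finset.subset_of_eq (hIT K).symm))
  calc (partialLaw (T K) (ν K a t) (small K) (u K) (fun s => a (lvl K s)) s).map (u K s)
      ≤ (ENNReal.ofReal (Real.exp (l₀ * B)) • ∑ τ ∈ (T K).filter (fun τ => s ∈ small K τ), J K a K τ).map (u K s) :=
        Measure.map_mono h1 (hu K s)
    _ = ENNReal.ofReal (Real.exp (l₀ * B)) • (∑ τ ∈ (T K).filter (fun τ => s ∈ small K τ), J K a K τ).map (u K s) :=
        Measure.map_smul _ _ _
    _ ≤ ENNReal.ofReal (Real.exp (l₀ * B)) • ((1 + ENNReal.ofReal δr) • (∑ e ∈ I K (lvl K s), Jpre K a (lvl K s) e).map (u K s)) :=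
        smul_le_smul_measure le_rfl h2
    _ = ENNReal.ofReal (Real.exp (l₀ * B) * (1 + δr)) • (∑ e ∈ I K (lvl K s), Jpre K a (lvl K s) e).map (u K s) := by
        rw [smul_smul, ENNReal.ofReal_mul (Real.exp_pos _).le, ENNReal.ofReal_add zero_le_one hδ, ENNReal.ofReal_one]

omit [DecidableEq σ] [∀ K a k e, IsFiniteMeasure (Jpre K a k e)] in
/-- **THE MASS SIDE OF ONE RUN** (`hmass` of §AM with `M₂ = e^{−l₀B}`): `law(univ)` = the pre-ℝ stage total's mass = the final stage's (mass chain)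
`≤ e^{l₀B} ×` the `t`-run's term masses (Tilt) = its history weights (absorption on `small ⊆ smAll`, 20k `histWeight_of_absorbing`). [folklore] -/
theorem mass_of_tower (hu : ∀ K s, Measurable (u K s)) (hle : ∀ K, ∀ s ∈ C K, lvl K s ≤ K)
    (hpre : ∀ K k, k < K → ∀ e ∈ I K (k + 1), pre K k e ∈ I K k) (hIT : ∀ K, I K K = T K)
    (hP : ∀ (K : ℕ) (a : ℕ → ℝ), (∀ j, a j ∈ Icc ((1 - κ j) * θ j) (θ j)) → ∀ k, k < K → ∀ s ∈ I K k,
      ∑ e ∈ (I K (k + 1)).filter (fun e => pre K k e = s), Jpre K a (k + 1) e = J K a k s)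
    (hmass : ∀ (K : ℕ) (a : ℕ → ℝ), (∀ j, a j ∈ Icc ((1 - κ j) * θ j) (θ j)) → ∀ k, k ≤ K →
      (∑ s ∈ I K k, J K a k s) univ = (∑ s ∈ I K k, Jpre K a k s) univ)
    (htilt : ∀ (K : ℕ) (a : ℕ → ℝ), (∀ j, a j ∈ Icc ((1 - κ j) * θ j) (θ j)) → ∀ t, |t| ≤ l₀ → ∀ τ ∈ T K,
      ν K a t τ ≤ ENNReal.ofReal (Real.exp (l₀ * B)) • J K a K τ ∧ J K a K τ ≤ ENNReal.ofReal (Real.exp (l₀ * B)) • ν K a t τ)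
    (hsub : ∀ K, ∀ τ ∈ T K, small K τ ⊆ smAll K τ)
    (habs : ∀ (K : ℕ) (a : ℕ → ℝ), (∀ j, a j ∈ Icc ((1 - κ j) * θ j) (θ j)) → ∀ t, |t| ≤ l₀ → ∀ τ ∈ T K,
      Absorbing (ν K a t τ) (smAll K τ) (u K) (fun c => a (lvl K c)))
    (K : ℕ) (a : ℕ → ℝ) (ha : ∀ j, a j ∈ Icc ((1 - κ j) * θ j) (θ j)) (t : ℝ) (ht : |t| ≤ l₀) (s : σ) (hs : s ∈ C K) :
    Real.exp (-(l₀ * B)) * ((∑ e ∈ I K (lvl K s), Jpre K a (lvl K s) e).map (u K s) univ).toReal ≤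
      ∑ τ ∈ T K, histWeight (ν K a t τ) (small K τ) (u K) (fun s => a (lvl K s)) := by
  rw [map_univ_eq (hu K s), totPre_univ_eq_final K (I K) (J K a) (Jpre K a) (pre K) (hpre K) (hP K a ha) (hmass K a ha) (hle K s hs),
    hIT K, Measure.finsetSum_apply, ENNReal.toReal_sum (fun τ _ => measure_ne_top _ _), Finset.mul_sum]
  refine Finset.sum_le_sum fun τ hτ => ?_
  rw [histWeight_of_absorbing _ _ _ ((habs K a ha t ht τ hτ).mono (hsub K τ hτ))]
  have h1 : J K a K τ univ ≤ ENNReal.ofReal (Real.exp (l₀ * B)) * ν K a t τ univ := by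
    have := Measure.le_iff'.1 (htilt K a ha t ht τ hτ).2 univ
    rwa [Measure.smul_apply, smul_eq_mul] at this
  have h2 : (J K a K τ univ).toReal ≤ Real.exp (l₀ * B) * (ν K a t τ univ).toReal := by
    have := ENNReal.toReal_mono (ENNReal.mul_ne_top ENNReal.ofReal_ne_top (measure_ne_top _ _)) h1
    rwa [ENNReal.toReal_mul, ENNReal.toReal_ofReal (Real.exp_pos _).le] at this
  calc Real.exp (-(l₀ * B)) * (J K a K τ univ).toReal
      ≤ Real.exp (-(l₀ * B)) * (Real.exp (l₀ * B) * (ν K a t τ univ).toReal) := mul_le_mul_of_nonneg_left h2 (Real.exp_pos _).le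
    _ = (ν K a t τ univ).toReal := by rw [← mul_assoc, ← Real.exp_add, neg_add_cancel, Real.exp_zero, one_mul]

end OneRunTower

variable {νA νB : ∀ K : ℕ, (ℕ → ℝ) → ℝ → ι → Measure (Ω K)} [∀ K a t τ, IsFiniteMeasure (νA K a t τ)] [∀ K a t τ, IsFiniteMeasure (νB K a t τ)]
  {JA JpreA JB JpreB : ∀ K : ℕ, (ℕ → ℝ) → ℕ → ι → Measure (Ω K)}
  [∀ K a k e, IsFiniteMeasure (JA K a k e)] [∀ K a k e, IsFiniteMeasure (JpreA K a k e)]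
  [∀ K a k e, IsFiniteMeasure (JB K a k e)] [∀ K a k e, IsFiniteMeasure (JpreB K a k e)]
  {uA uB : ∀ K : ℕ, σ → Ω K → ℝ}

/-- **N21's ROAD I ON HISTORY FAMILIES FROM THE RESAMPLING TOWER (end-to-end).**  Closeness exactly as in §AM ∕ 20l (N16-det at the nominal `θ`
on `nbhd ⊆ smAll`, absorption on `smAll` at the selected `a`); the (M1)-currency is supplied by the two runs' ℝ∕𝐓 towers under the RESAMPLING
LIFT: shared combinatorics (`I`, `pre`, `sel`, `On`, `hIT : I K K = T K`), per run the stage laws `J ∕ Jpre` with (P) `hP`, (N) `hN`, (Eoff) `hoff`,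
(Eon) `hon` (ONE local number `δ`), (Mass) `hmass`, (Tilt) `htilt` (`|F| ≤ B`), and older-causality of the pre-ℝ stage totals `hdepTot`.
Conclusion: module 20's constant with `M₁ ∕ M₂ = e^{2l₀B}(1+δ)`. [folklore] -/
theorem shellWeightBound_histories_of_resamplingTower {N₁ : ℕ} {κmin c₁ ϑ : ℝ}
    (huA : ∀ K s, Measurable (uA K s)) (huB : ∀ K s, Measurable (uB K s))
    (hsmall : ∀ K, ∀ τ ∈ T K, small K τ ⊆ C K) (hsub : ∀ K, ∀ τ ∈ T K, small K τ ⊆ smAll K τ)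
    (hθ : ∀ j, 0 < θ j) (hκ : ∀ j, 0 < κ j ∧ κ j ≤ 1) (hρ : ∀ j, 0 ≤ ρ j ∧ ρ j < 1)
    (hwin : LiveWindow C lvl N₁ νbar) (hδ : 0 ≤ δr)
    (hΔ : ∀ j, Δ j ≤ ρ j * ((1 - κ j) * θ j))
    (hgeom : ∀ K, ∀ τ ∈ T K, ∀ s ∈ small K τ, nbhd K τ s ⊆ smAll K τ)
    (hdetA : ∀ K, ∀ τ ∈ T K, ∀ s ∈ small K τ, ∀ ω, (∀ c ∈ nbhd K τ s, uA K c ω < θ (lvl K c)) → |uA K s ω - uB K s ω| ≤ Δ (lvl K s))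
    (hdetB : ∀ K, ∀ τ ∈ T K, ∀ s ∈ small K τ, ∀ ω, (∀ c ∈ nbhd K τ s, uB K c ω < θ (lvl K c)) → |uB K s ω - uA K s ω| ≤ Δ (lvl K s))
    (habsA : ∀ (K : ℕ) (a : ℕ → ℝ), (∀ j, a j ∈ Icc ((1 - κ j) * θ j) (θ j)) → ∀ t, |t| ≤ l₀ → ∀ τ ∈ T K,
      Absorbing (νA K a t τ) (smAll K τ) (uA K) (fun c => a (lvl K c)))
    (habsB : ∀ (K : ℕ) (a : ℕ → ℝ), (∀ j, a j ∈ Icc ((1 - κ j) * θ j) (θ j)) → ∀ t, |t| ≤ l₀ → ∀ τ ∈ T K,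
      Absorbing (νB K a t τ) (smAll K τ) (uB K) (fun c => a (lvl K c)))
    -- the tower: combinatorics shared by the two runs
    (hpre : ∀ K k, k < K → ∀ e ∈ I K (k + 1), pre K k e ∈ I K k) (hIT : ∀ K, I K K = T K)
    (hsel : ∀ K k, ∀ s ∈ I K k, sel K k s ∈ I K k)
    -- run A: stage laws
    (hPA : ∀ (K : ℕ) (a : ℕ → ℝ), (∀ j, a j ∈ Icc ((1 - κ j) * θ j) (θ j)) → ∀ k, k < K → ∀ s ∈ I K k,
      ∑ e ∈ (I K (k + 1)).filter (fun e => pre K k e = s), JpreA K a (k + 1) e = JA K a k s)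
    (hNA : ∀ (K : ℕ) (a : ℕ → ℝ), (∀ j, a j ∈ Icc ((1 - κ j) * θ j) (θ j)) → ∀ c ∈ C K, ∀ k, lvl K c < k → k ≤ K → ∀ s ∈ I K k,
      (JA K a k s).map (uA K c) = (JpreA K a k s).map (uA K c))
    (hoffA : ∀ (K : ℕ) (a : ℕ → ℝ), (∀ j, a j ∈ Icc ((1 - κ j) * θ j) (θ j)) → ∀ c ∈ C K, ∀ s ∈ I K (lvl K c), s ∉ On K (lvl K c) c →
      (JA K a (lvl K c) s).map (uA K c) = (JpreA K a (lvl K c) s).map (uA K c))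
    (honA : ∀ (K : ℕ) (a : ℕ → ℝ), (∀ j, a j ∈ Icc ((1 - κ j) * θ j) (θ j)) → ∀ c ∈ C K, ∀ s' ∈ I K (lvl K c),
      ∑ s ∈ (I K (lvl K c)).filter (fun s => s ∈ On K (lvl K c) c ∧ sel K (lvl K c) s = s'), (JA K a (lvl K c) s).map (uA K c) ≤
        ENNReal.ofReal δr • ∑ s ∈ (I K (lvl K c)).filter (fun s => s ∉ On K (lvl K c) c ∧ sel K (lvl K c) s = s'), (JpreA K a (lvl K c) s).map (uA K c))
    (hmassA : ∀ (K : ℕ) (a : ℕ → ℝ), (∀ j, a j ∈ Icc ((1 - κ j) * θ j) (θ j)) → ∀ k, k ≤ K →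
      (∑ s ∈ I K k, JA K a k s) univ = (∑ s ∈ I K k, JpreA K a k s) univ)
    (htiltA : ∀ (K : ℕ) (a : ℕ → ℝ), (∀ j, a j ∈ Icc ((1 - κ j) * θ j) (θ j)) → ∀ t, |t| ≤ l₀ → ∀ τ ∈ T K,
      νA K a t τ ≤ ENNReal.ofReal (Real.exp (l₀ * B)) • JA K a K τ ∧ JA K a K τ ≤ ENNReal.ofReal (Real.exp (l₀ * B)) • νA K a t τ)
    (hdepTotA : ∀ (K : ℕ) (s : σ) (a b : ℕ → ℝ), (∀ i, i < lvl K s → a i = b i) →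
      ∑ e ∈ I K (lvl K s), JpreA K a (lvl K s) e = ∑ e ∈ I K (lvl K s), JpreA K b (lvl K s) e)
    -- run B: stage laws
    (hPB : ∀ (K : ℕ) (a : ℕ → ℝ), (∀ j, a j ∈ Icc ((1 - κ j) * θ j) (θ j)) → ∀ k, k < K → ∀ s ∈ I K k,
      ∑ e ∈ (I K (k + 1)).filter (fun e => pre K k e = s), JpreB K a (k + 1) e = JB K a k s)
    (hNB : ∀ (K : ℕ) (a : ℕ → ℝ), (∀ j, a j ∈ Icc ((1 - κ j) * θ j) (θ j)) → ∀ c ∈ C K, ∀ k, lvl K c < k → k ≤ K → ∀ s ∈ I K k,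
      (JB K a k s).map (uB K c) = (JpreB K a k s).map (uB K c))
    (hoffB : ∀ (K : ℕ) (a : ℕ → ℝ), (∀ j, a j ∈ Icc ((1 - κ j) * θ j) (θ j)) → ∀ c ∈ C K, ∀ s ∈ I K (lvl K c), s ∉ On K (lvl K c) c →
      (JB K a (lvl K c) s).map (uB K c) = (JpreB K a (lvl K c) s).map (uB K c))
    (honB : ∀ (K : ℕ) (a : ℕ → ℝ), (∀ j, a j ∈ Icc ((1 - κ j) * θ j) (θ j)) → ∀ c ∈ C K, ∀ s' ∈ I K (lvl K c),
      ∑ s ∈ (I K (lvl K c)).filter (fun s => s ∈ On K (lvl K c) c ∧ sel K (lvl K c) s = s'), (JB K a (lvl K c) s).map (uB K c) ≤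
        ENNReal.ofReal δr • ∑ s ∈ (I K (lvl K c)).filter (fun s => s ∉ On K (lvl K c) c ∧ sel K (lvl K c) s = s'), (JpreB K a (lvl K c) s).map (uB K c))
    (hmassB : ∀ (K : ℕ) (a : ℕ → ℝ), (∀ j, a j ∈ Icc ((1 - κ j) * θ j) (θ j)) → ∀ k, k ≤ K →
      (∑ s ∈ I K k, JB K a k s) univ = (∑ s ∈ I K k, JpreB K a k s) univ)
    (htiltB : ∀ (K : ℕ) (a : ℕ → ℝ), (∀ j, a j ∈ Icc ((1 - κ j) * θ j) (θ j)) → ∀ t, |t| ≤ l₀ → ∀ τ ∈ T K,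
      νB K a t τ ≤ ENNReal.ofReal (Real.exp (l₀ * B)) • JB K a K τ ∧ JB K a K τ ≤ ENNReal.ofReal (Real.exp (l₀ * B)) • νB K a t τ)
    (hdepTotB : ∀ (K : ℕ) (s : σ) (a b : ℕ → ℝ), (∀ i, i < lvl K s → a i = b i) →
      ∑ e ∈ I K (lvl K s), JpreB K a (lvl K s) e = ∑ e ∈ I K (lvl K s), JpreB K b (lvl K s) e)
    (hκmin : 0 < κmin) (hκminle : ∀ j, κmin ≤ κ j) (hρhalf : ∀ j, ρ j ≤ 1 / 2)
    (hϑ0 : 0 < ϑ) (hϑ1 : ϑ < 1) (hrate : ∀ j, ρ j ≤ c₁ * ϑ ^ j) :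
    ∃ a : ℕ → ℕ → ℝ, (∀ K j, a K j ∈ Icc ((1 - κ j) * θ j) (θ j)) ∧
      ShellWeightBound l₀ T (fun K t τ => histWeight (νA K (a K) t τ) (small K τ) (uA K) (fun s => a K (lvl K s)))
        (fun K t τ => histWeight (νB K (a K) t τ) (small K τ) (uB K) (fun s => a K (lvl K s)))
        (fun K t τ => histShell (νA K (a K) t τ) (small K τ) (uA K) (uB K) (fun s => a K (lvl K s)))
        (fun K t τ => histShell (νB K (a K) t τ) (small K τ) (uB K) (uA K) (fun s => a K (lvl K s)))
        fun K => (2 * ((N₁ + 1) * νbar * (Real.exp (l₀ * B) * (1 + δr) / Real.exp (-(l₀ * B)) * (2 * (2 * νbar) / κmin)) * c₁ * ϑ⁻¹ ^ N₁)) *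
          ϑ ^ K := by
  have hM₁ : 0 ≤ Real.exp (l₀ * B) * (1 + δr) := by positivity
  haveI hfA : ∀ K a s, IsFiniteMeasure ((∑ e ∈ I K (lvl K s), JpreA K a (lvl K s) e).map (uA K s)) := fun K a s => inferInstance
  haveI hfB : ∀ K a s, IsFiniteMeasure ((∑ e ∈ I K (lvl K s), JpreB K a (lvl K s) e).map (uB K s)) := fun K a s => inferInstance
  exact shellWeightBound_histories_of_absorbing_marginal
    (lawA := fun K a s => (∑ e ∈ I K (lvl K s), JpreA K a (lvl K s) e).map (uA K s))
    (lawB := fun K a s => (∑ e ∈ I K (lvl K s), JpreB K a (lvl K s) e).map (uB K s))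
    huA huB hsmall hθ hκ hρ hwin hM₁ (Real.exp_pos _)
    (fun K s a b hab => congrArg (fun m : Measure (Ω K) => m.map (uA K s)) (hdepTotA K s a b hab))
    (fun K s a b hab => congrArg (fun m : Measure (Ω K) => m.map (uB K s)) (hdepTotB K s a b hab))
    hΔ hgeom hdetA hdetB habsA habsB
    (marginalEnvelope_of_tower huA hwin.le_top hδ hpre hIT hsel hPA hNA hoffA honA htiltA)
    (marginalEnvelope_of_tower huB hwin.le_top hδ hpre hIT hsel hPB hNB hoffB honB htiltB)
    (mass_of_tower huA hwin.le_top hpre hIT hPA hmassA htiltA hsub habsA)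
    (mass_of_tower huB hwin.le_top hpre hIT hPB hmassB htiltB hsub habsB)
    hκmin hκminle hρhalf hϑ0 hϑ1 hrate

end Resampling

end Summit.QuantumFields.YangMills.Theorems.N21HistoriesResamplingTower
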